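import Summits.AtomisticToContinuum.BoseEinsteinCondensation.Theorems.BECCutLineWeakDisorderTaggedShiftCameronMartinRamp
import Literature.MathematicalPhysics.QuantumManyBody.GroundStateFeynmanKacCutLine
import Mathlib.MeasureTheory.Constructions.Pi
import HarnessLib

/-!
# Route `BECCutLineWeakDisorder`, crux `TwoReplicaTransienceBound` (stmt-AtomisticToContinuum-9687),
# line `tagged-shift-log-harnack`: Cameron–Martin for a ramp drift of the TAGGED world-line inside
# the `(n+1)`-line Wiener measure

Support file (lead a1). The landed toolbox stub `stub_cameronMartinRamp`
(`Theorems/BECCutLineWeakDisorderTaggedShiftCameronMartinRamp.lean`) is the one-dimensional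
Cameron–Martin identity `E[G(b + a·min(·,τ₀))] = E[G(b) e^{a b_{τ₀} - a²τ₀/2}]` for the canonical
Brownian motion under `preWienerMeasure`. The lever of the line shifts the three Brownian
coordinates of ONE particle (the tagged one, index `0`) of the `(n+1)`-line sample
`ω : PathSpace (n+1)` under `wienerPaths (n+1) = ⨂_{i,k} preWienerMeasure`; this file lifts the
one-dimensional identity to that setting by Tonelli over the product structure:

* `lintegral_pi_shift` — abstract induction over a finite product `Measure.pi (fun _ : Fin m => μ)`:
  if for every parameter `a` and every measurable `G ≥ 0`, `∫ G (f a x) dμ = ∫ G (g x) · d a x dμ`,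
  then for every measurable `H ≥ 0` on `Fin m → Y`,
  `∫ H (j ↦ f (a j) (x j)) d(⨂μ) = ∫ H (j ↦ g (x j)) · ∏_j d (a j) (x j) d(⨂μ)`;
* `lintegral_wienerLine_rampShift` — the three coordinates of one line (`Fin 3 → (ℝ≥0 → ℝ)`);
* `lintegral_wienerPaths_taggedRampShift` — the `(n+1)`-line statement: for measurable
  `H : PathSpace (n+1) → [0,∞]`,
  `∫ H (taggedRampShift a τ₀ (brownianPaths ω)) dW = ∫ H (brownianPaths ω) · taggedRampDensity a τ₀ ω dW`,
  where `brownianPaths ω i k = (u ↦ b_u(ω i k))`, the shift adds `a k · min(u, τ₀)` to the tagged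
  coordinates `(0, k)` only, and the density is `∏_k exp(a_k b_{τ₀}(ω 0 k) - a_k² τ₀/2)`.

This is the change-of-measure engine of the phantom-window identity (★) of LeadA1Report §2
(`φ_T(x″+z, Y) = E[ℛ_z · (ghost weight)]`): with `a = -z/(√2 τ₀)` the shifted tagged world-line
started at `x″ + z` is the GHOST `x″ + √2 b_s + (1 - s/τ₀)₊ z`.

References: R. H. Cameron, W. T. Martin, Ann. Math. 45 (1944); P. Mörters, Y. Peres, *Brownian
Motion* (2010), Thm 1.38. [folklore lift of the landed one-dimensional statement]
-/

noncomputable section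

open MeasureTheory Filter Set Finset
open scoped ENNReal NNReal Topology BigOperators

namespace Summit.AtomisticToContinuum.BoseEinsteinCondensation.Cruxes.TwoReplicaTransienceBound.TaggedShiftLogHarnack

open Literature.MathematicalPhysics.QuantumManyBody.BoseGas
open Literature.Probability.Process Literature.Probability.RandomPlanarGeometry

/-! ### Abstract Tonelli induction over a finite product -/

/-- **Coordinatewise change of variables with densities over a finite product** (Tonelli
induction): if `∫ G (f a x) dμ = ∫ G (g x) · d a x dμ` for every parameter `a` and every measurable
`G ≥ 0`, then for every `m`, every `a : Fin m → A` and every measurable `H ≥ 0` on `Fin m → Y`,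
`∫ H (j ↦ f (a j) (x j)) d(⨂_{Fin m} μ) = ∫ H (j ↦ g (x j)) · ∏_j d (a j) (x j) d(⨂_{Fin m} μ)`.
[folklore] -/
theorem lintegral_pi_shift {X Y A : Type*} [MeasurableSpace X] [MeasurableSpace Y]
    (μ : Measure X) [SigmaFinite μ] {f : A → X → Y} {g : X → Y} {d : A → X → ℝ≥0∞}
    (hf : ∀ a, Measurable (f a)) (hg : Measurable g) (hd : ∀ a, Measurable (d a))
    (hCM : ∀ (a : A) (G : Y → ℝ≥0∞), Measurable G →
      ∫⁻ x, G (f a x) ∂μ = ∫⁻ x, G (g x) * d a x ∂μ) :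
    ∀ (m : ℕ) (a : Fin m → A) (H : (Fin m → Y) → ℝ≥0∞), Measurable H →
      ∫⁻ x, H (fun j => f (a j) (x j)) ∂Measure.pi (fun _ : Fin m => μ) =
        ∫⁻ x, H (fun j => g (x j)) * ∏ j, d (a j) (x j) ∂Measure.pi (fun _ : Fin m => μ) := by
  intro m
  induction m with
  | zero =>
    intro a H _
    simp only [Finset.univ_eq_empty, Finset.prod_empty, mul_one]
    congr 1
    funext x
    congr 1
    funext j
    exact Fin.elim0 j
  | succ m ih =>
    intro a H hH
    -- split off coordinate `0`: `⨂_{Fin (m+1)} μ ≅ μ ⊗ ⨂_{Fin m} μ` along `Fin.cons`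
    set e := MeasurableEquiv.piFinSuccAbove (fun _ : Fin (m + 1) => X) 0 with he
    have hmp : MeasurePreserving e (Measure.pi fun _ : Fin (m + 1) => μ)
        (μ.prod (Measure.pi fun _ : Fin m => μ)) :=
      measurePreserving_piFinSuccAbove (fun _ : Fin (m + 1) => μ) 0
    have hsymm : ∀ p : X × (Fin m → X), e.symm p = Fin.cons p.1 p.2 := fun p => by
      simp [he, MeasurableEquiv.piFinSuccAbove_symm_apply, Fin.insertNthEquiv, Fin.insertNth_zero']
    -- the two integrands, as functions on the product
    have hL : ∀ x : Fin (m + 1) → X, (fun j => f (a j) (x j)) =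
        Fin.cons (f (a 0) (x 0)) (fun k => f (a k.succ) (x k.succ)) := fun x => by
      funext j; refine Fin.cases ?_ (fun k => ?_) j <;> simp
    have hR : ∀ x : Fin (m + 1) → X, (fun j => g (x j)) =
        Fin.cons (g (x 0)) (fun k => g (x k.succ)) := fun x => by
      funext j; refine Fin.cases ?_ (fun k => ?_) j <;> simp
    -- measurability of the pieces
    have hcons : Measurable fun p : Y × (Fin m → Y) => (Fin.cons p.1 p.2 : Fin (m + 1) → Y) := by
      refine measurable_pi_lambda _ fun j => ?_
      refine Fin.cases ?_ (fun k => ?_) j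
      · simpa using measurable_fst
      · simp only [Fin.cons_succ]
        exact (measurable_pi_apply k).comp measurable_snd
    have hFrest : Measurable fun r : Fin m → X => fun k => f (a k.succ) (r k) :=
      measurable_pi_lambda _ fun k => (hf _).comp (measurable_pi_apply k)
    have hGrest : Measurable fun r : Fin m → X => fun k => g (r k) :=
      measurable_pi_lambda _ fun k => hg.comp (measurable_pi_apply k)
    have hDrest : Measurable fun r : Fin m → X => ∏ k, d (a k.succ) (r k) :=
      Finset.measurable_prod _ fun k _ => (hd _).comp (measurable_pi_apply k)
    -- LHS through the product
    have h1 : ∫⁻ x, H (fun j => f (a j) (x j)) ∂Measure.pi (fun _ : Fin (m + 1) => μ) =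
        ∫⁻ x₀, ∫⁻ r, H (Fin.cons (f (a 0) x₀) (fun k => f (a k.succ) (r k)))
          ∂Measure.pi (fun _ : Fin m => μ) ∂μ := by
      have hΦ : Measurable fun p : X × (Fin m → X) =>
          H (Fin.cons (f (a 0) p.1) (fun k => f (a k.succ) (p.2 k))) :=
        hH.comp (hcons.comp (((hf _).comp measurable_fst).prodMk (hFrest.comp measurable_snd)))
      rw [← hmp.symm.lintegral_comp_emb e.symm.measurableEmbedding]
      simp only [hsymm, hL, Fin.cons_zero, Fin.cons_succ]
      exact lintegral_prod _ hΦ.aemeasurable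
    -- RHS through the product
    have h2 : ∫⁻ x, H (fun j => g (x j)) * ∏ j, d (a j) (x j) ∂Measure.pi (fun _ : Fin (m + 1) => μ) =
        ∫⁻ x₀, ∫⁻ r, H (Fin.cons (g x₀) (fun k => g (r k))) * (d (a 0) x₀ * ∏ k, d (a k.succ) (r k))
          ∂Measure.pi (fun _ : Fin m => μ) ∂μ := by
      have hΨ : Measurable fun p : X × (Fin m → X) =>
          H (Fin.cons (g p.1) (fun k => g (p.2 k))) * (d (a 0) p.1 * ∏ k, d (a k.succ) (p.2 k)) :=
        (hH.comp (hcons.comp ((hg.comp measurable_fst).prodMk (hGrest.comp measurable_snd)))).mul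
          (((hd _).comp measurable_fst).mul (hDrest.comp measurable_snd))
      rw [← hmp.symm.lintegral_comp_emb e.symm.measurableEmbedding]
      simp only [hsymm, hR, Fin.prod_univ_succ, Fin.cons_zero, Fin.cons_succ]
      exact lintegral_prod _ hΨ.aemeasurable
    rw [h1, h2]
    -- the inner integral: induction hypothesis, for each `y`
    have hinner : ∀ y : Y, ∫⁻ r, H (Fin.cons y (fun k => f (a k.succ) (r k))) ∂Measure.pi (fun _ : Fin m => μ) =
        ∫⁻ r, H (Fin.cons y (fun k => g (r k))) * ∏ k, d (a k.succ) (r k) ∂Measure.pi (fun _ : Fin m => μ) := by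
      intro y
      have hHy : Measurable fun q : Fin m → Y => H (Fin.cons y q) :=
        hH.comp (hcons.comp (measurable_const.prodMk measurable_id))
      exact ih (fun k => a k.succ) (fun q => H (Fin.cons y q)) hHy
    simp_rw [hinner]
    -- the outer integral: the one-coordinate hypothesis at `a 0`
    set Φ : Y → ℝ≥0∞ := fun y =>
      ∫⁻ r, H (Fin.cons y (fun k => g (r k))) * ∏ k, d (a k.succ) (r k) ∂Measure.pi (fun _ : Fin m => μ) with hΦdef
    have hΦm : Measurable Φ := by
      have : Measurable (Function.uncurry fun (y : Y) (r : Fin m → X) =>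
          H (Fin.cons y (fun k => g (r k))) * ∏ k, d (a k.succ) (r k)) :=
        (hH.comp (hcons.comp (measurable_fst.prodMk (hGrest.comp measurable_snd)))).mul
          (hDrest.comp measurable_snd)
      exact this.lintegral_prod_right'
    have hout := hCM (a 0) Φ hΦm
    simp only [hΦdef] at hout
    rw [hout]
    refine lintegral_congr fun x₀ => ?_
    have hF : Measurable fun r : Fin m → X =>
        H (Fin.cons (g x₀) fun k => g (r k)) * ∏ k, d (a k.succ) (r k) :=
      (hH.comp (hcons.comp (measurable_const.prodMk hGrest))).mul hDrest
    rw [mul_comm, ← lintegral_const_mul _ hF]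
    refine lintegral_congr fun r => ?_
    ring

/-! ### The three coordinates of one line -/

/-- The law of the three Brownian coordinates of ONE world-line: `⨂_{Fin 3} preWienerMeasure`
(`wienerPaths 1 ≅` one copy of it; `wienerPaths (n+1) ≅ ⨂_{Fin (n+1)}` copies). [folklore] -/
def lineMeasure : Measure (Fin 3 → (ℝ≥0 → ℝ)) := Measure.pi fun _ : Fin 3 => preWienerMeasure

/-- `wienerPaths N = ⨂_{Fin N} lineMeasure` (definitional). [folklore] -/
theorem wienerPaths_eq_pi_lineMeasure (N : ℕ) :
    wienerPaths N = Measure.pi fun _ : Fin N => lineMeasure := rfl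

/-- The ramp-shifted Brownian coordinates of one line: `k ↦ (u ↦ b_u(ω k) + a_k min(u, τ₀))`. -/
def lineRampShift (a : Fin 3 → ℝ) (τ₀ : ℝ≥0) (ω : Fin 3 → (ℝ≥0 → ℝ)) : Fin 3 → (ℝ≥0 → ℝ) :=
  fun k u => brownian u (ω k) + a k * ((min u τ₀ : ℝ≥0) : ℝ)

/-- The Brownian coordinates of one line: `k ↦ (u ↦ b_u(ω k))`. -/
def lineBrownian (ω : Fin 3 → (ℝ≥0 → ℝ)) : Fin 3 → (ℝ≥0 → ℝ) := fun k u => brownian u (ω k)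

/-- The Cameron–Martin density of the three ramps: `∏_k exp(a_k b_{τ₀}(ω k) - a_k² τ₀/2)`. -/
def lineRampDensity (a : Fin 3 → ℝ) (τ₀ : ℝ≥0) (ω : Fin 3 → (ℝ≥0 → ℝ)) : ℝ≥0∞ :=
  ∏ k : Fin 3, ENNReal.ofReal (Real.exp (a k * brownian τ₀ (ω k) - a k ^ 2 * (τ₀ : ℝ) / 2))

/-- `lineRampShift` is measurable. [folklore] -/
theorem measurable_lineRampShift (a : Fin 3 → ℝ) (τ₀ : ℝ≥0) : Measurable (lineRampShift a τ₀) :=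
  measurable_pi_lambda _ fun k => (measurable_rampPath (a k) τ₀).comp (measurable_pi_apply k)

/-- `lineBrownian` is measurable. [folklore] -/
theorem measurable_lineBrownian : Measurable lineBrownian :=
  measurable_pi_lambda _ fun k => measurable_brownianPath.comp (measurable_pi_apply k)

/-- `lineRampDensity` is measurable. [folklore] -/
theorem measurable_lineRampDensity (a : Fin 3 → ℝ) (τ₀ : ℝ≥0) : Measurable (lineRampDensity a τ₀) :=
  Finset.measurable_prod _ fun k _ => (measurable_rampDensity (a k) τ₀).comp (measurable_pi_apply k)

/-- **Cameron–Martin for the three ramp-shifted coordinates of one line**: for measurable `H ≥ 0`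
on `Fin 3 → (ℝ≥0 → ℝ)`,
`∫ H (lineRampShift a τ₀ ω) = ∫ H (lineBrownian ω) · lineRampDensity a τ₀ ω` under `lineMeasure`
(the landed one-dimensional `stub_cameronMartinRamp`, coordinate by coordinate, by
`lintegral_pi_shift`). [folklore] -/
theorem lintegral_lineMeasure_rampShift (a : Fin 3 → ℝ) (τ₀ : ℝ≥0)
    {H : (Fin 3 → (ℝ≥0 → ℝ)) → ℝ≥0∞} (hH : Measurable H) :
    ∫⁻ ω, H (lineRampShift a τ₀ ω) ∂lineMeasure =
      ∫⁻ ω, H (lineBrownian ω) * lineRampDensity a τ₀ ω ∂lineMeasure := by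
  haveI : IsProbabilityMeasure preWienerMeasure := isProbabilityMeasure_preWienerMeasure'
  have h := lintegral_pi_shift (X := ℝ≥0 → ℝ) (Y := ℝ≥0 → ℝ) (A := ℝ) preWienerMeasure
    (f := fun (b : ℝ) (ω : ℝ≥0 → ℝ) (s : ℝ≥0) => brownian s ω + b * ((min s τ₀ : ℝ≥0) : ℝ))
    (g := fun (ω : ℝ≥0 → ℝ) (s : ℝ≥0) => brownian s ω)
    (d := fun (b : ℝ) (ω : ℝ≥0 → ℝ) => ENNReal.ofReal (Real.exp (b * brownian τ₀ ω - b ^ 2 * (τ₀ : ℝ) / 2)))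
    (fun b => measurable_rampPath b τ₀) measurable_brownianPath (fun b => measurable_rampDensity b τ₀)
    (fun b G hG => stub_cameronMartinRamp b τ₀ G hG) 3 a H hH
  simp only [lineMeasure]
  exact h

/-! ### The tagged line inside the `(n+1)`-line Wiener measure -/

variable {n : ℕ}

/-- The Brownian paths of a sample: `(brownianPaths ω) i k = (u ↦ b_u(ω i k))` (the map through which
`worldLine`, hence `fkWeight`, reads `ω`). -/
def brownianPaths {N : ℕ} (ω : PathSpace N) : PathSpace N := fun i k u => brownian u (ω i k)

/-- The ramp shift of the TAGGED line (index `0`) of a path sample: coordinate `(0, k)` is shifted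
by `u ↦ a_k · min(u, τ₀)`, the bath lines are untouched. With `a = -z/(√2 τ₀)` and the Brownian
paths of `ω`, the tagged world-line started at `x″ + z` along the shifted paths is the GHOST
`x″ + √2 b_s + (1 - s/τ₀)₊ z` of LeadA1Report §2. -/
def taggedRampShift (a : Fin 3 → ℝ) (τ₀ : ℝ≥0) (w : PathSpace (n + 1)) : PathSpace (n + 1) :=
  fun i k u => w i k u + if i = 0 then a k * ((min u τ₀ : ℝ≥0) : ℝ) else 0

/-- The Cameron–Martin density of the tagged ramp shift:
`∏_k exp(a_k b_{τ₀}(ω 0 k) - a_k² τ₀/2)` (the factor `ℛ` of the phantom-window identity, up to the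
sign convention of `a`). -/
def taggedRampDensity (a : Fin 3 → ℝ) (τ₀ : ℝ≥0) (ω : PathSpace (n + 1)) : ℝ≥0∞ :=
  lineRampDensity a τ₀ (ω 0)

/-- `brownianPaths` is measurable. [folklore] -/
theorem measurable_brownianPaths {N : ℕ} : Measurable (brownianPaths (N := N)) :=
  measurable_pi_lambda _ fun i => measurable_lineBrownian.comp (measurable_pi_apply i)

/-- `taggedRampShift` is measurable. [folklore] -/
theorem measurable_taggedRampShift (a : Fin 3 → ℝ) (τ₀ : ℝ≥0) :
    Measurable (taggedRampShift (n := n) a τ₀) := by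
  refine measurable_pi_lambda _ fun i => measurable_pi_lambda _ fun k =>
    measurable_pi_lambda _ fun u => ?_
  exact (((measurable_pi_apply u).comp ((measurable_pi_apply k).comp (measurable_pi_apply i)))).add_const _

/-- `taggedRampDensity` is measurable. [folklore] -/
theorem measurable_taggedRampDensity (a : Fin 3 → ℝ) (τ₀ : ℝ≥0) :
    Measurable (taggedRampDensity (n := n) a τ₀) :=
  (measurable_lineRampDensity a τ₀).comp (measurable_pi_apply 0)

/-- **Cameron–Martin for a ramp drift of the tagged line inside the `(n+1)`-line Wiener measure.**
For every measurable `H : PathSpace (n+1) → [0, ∞]`,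
`∫ H (taggedRampShift a τ₀ (brownianPaths ω)) dW = ∫ H (brownianPaths ω) · taggedRampDensity a τ₀ ω dW`,
`W = wienerPaths (n+1)`: shifting the three Brownian coordinates of the tagged particle by the ramps
`u ↦ a_k min(u, τ₀)` is the change of measure by `∏_k exp(a_k b_{τ₀} - a_k²τ₀/2)`
(`lintegral_pi_shift` over the lines with the one-line statement at line `0` and the trivial shift
`a = 0` at the bath lines). Cameron–Martin (1944); Mörters–Peres Thm 1.38. [folklore] -/
theorem lintegral_wienerPaths_taggedRampShift (a : Fin 3 → ℝ) (τ₀ : ℝ≥0)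
    {H : PathSpace (n + 1) → ℝ≥0∞} (hH : Measurable H) :
    ∫⁻ ω, H (taggedRampShift a τ₀ (brownianPaths ω)) ∂wienerPaths (n + 1) =
      ∫⁻ ω, H (brownianPaths ω) * taggedRampDensity a τ₀ ω ∂wienerPaths (n + 1) := by
  haveI : IsProbabilityMeasure preWienerMeasure := isProbabilityMeasure_preWienerMeasure'
  haveI : IsProbabilityMeasure lineMeasure := by unfold lineMeasure; infer_instance
  -- one-line statement, parametrised by the slope vector (slope `0` = no shift, density `1`)
  have hCM : ∀ (b : Fin 3 → ℝ) (G : (Fin 3 → (ℝ≥0 → ℝ)) → ℝ≥0∞), Measurable G →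
      ∫⁻ ω, G (lineRampShift b τ₀ ω) ∂lineMeasure =
        ∫⁻ ω, G (lineBrownian ω) * lineRampDensity b τ₀ ω ∂lineMeasure :=
    fun b G hG => lintegral_lineMeasure_rampShift b τ₀ hG
  have h := lintegral_pi_shift (X := Fin 3 → (ℝ≥0 → ℝ)) (Y := Fin 3 → (ℝ≥0 → ℝ)) (A := Fin 3 → ℝ)
    lineMeasure (f := fun b => lineRampShift b τ₀) (g := lineBrownian) (d := fun b => lineRampDensity b τ₀)
    (fun b => measurable_lineRampShift b τ₀) measurable_lineBrownian
    (fun b => measurable_lineRampDensity b τ₀) hCM (n + 1) (fun i => if i = 0 then a else 0) H hH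
  -- identify the two sides
  have hshift : ∀ ω : PathSpace (n + 1),
      (fun j => lineRampShift (if j = 0 then a else 0) τ₀ (ω j)) = taggedRampShift a τ₀ (brownianPaths ω) := by
    intro ω; funext i k u
    by_cases hi : i = 0
    · subst hi; simp [lineRampShift, taggedRampShift, brownianPaths]
    · simp [lineRampShift, taggedRampShift, brownianPaths, hi]
  have hdens : ∀ ω : PathSpace (n + 1),
      ∏ j, lineRampDensity (if j = 0 then a else 0) τ₀ (ω j) = taggedRampDensity a τ₀ ω := by
    intro ω
    rw [Fin.prod_univ_succ]
    have h0 : ∀ j : Fin n, lineRampDensity 0 τ₀ (ω j.succ) = 1 := by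
      intro j
      simp [lineRampDensity]
    simp [h0, taggedRampDensity]
  have hbrown : ∀ ω : PathSpace (n + 1), (fun j => lineBrownian (ω j)) = brownianPaths ω := fun ω => rfl
  simp only [hshift, hdens, hbrown, wienerPaths_eq_pi_lineMeasure] at h ⊢
  exact h

/-- Registered toolbox stub `stub_taggedCameronMartin` of the line (lead a1): the `(n+1)`-line
Cameron–Martin statement for a ramp drift of the tagged line, all particle numbers
(= `lintegral_wienerPaths_taggedRampShift`). -/
theorem stub_taggedCameronMartin : ∀ (n : ℕ) (a : Fin 3 → ℝ) (τ₀ : ℝ≥0)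
    (H : PathSpace (n + 1) → ℝ≥0∞), Measurable H →
      ∫⁻ ω, H (taggedRampShift a τ₀ (brownianPaths ω)) ∂wienerPaths (n + 1) =
        ∫⁻ ω, H (brownianPaths ω) * taggedRampDensity a τ₀ ω ∂wienerPaths (n + 1) :=
  fun _ a τ₀ _ hH => lintegral_wienerPaths_taggedRampShift a τ₀ hH

end Summit.AtomisticToContinuum.BoseEinsteinCondensation.Cruxes.TwoReplicaTransienceBound.TaggedShiftLogHarnack

end
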